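import Mathlib
import Literature.Analysis.OperatorTheory.ContractiveDetComplexity
import Literature.Analysis.OperatorTheory.ContractiveDeterminantalRepresentations
import HarnessLib

/-!
# ♦ one-large-class case — piece (d) `piece_d_assembly`: assembly of the realisation

Crux `PriceOfContractivity` (stmt-ValiantsHypothesis-10583), line `birth`, registered stub
`stub_stableLifting_oneLargeClass`, piece `piece_d_assembly` of the mini-skeleton.

Given colours `x, c₁, c₂`, a scale `r > 0`, `M ≥ 1` and univariate polynomials `a, E₁, E₂, E₃`
(degree `≤ N + 1`, `a₀ = 1`) we build the explicit matrix
`K₁ = [[A′, B′], [C′, D′]]` on `Fin (N+1) ⊕ Fin 3`, coloured `(x, …, x, c₁, c₂, c₂)`: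
* `A′ = -r Sᵀ`, `S` the companion ("backward shift") matrix of the RESCALED coefficient sequence
  `â_j = a_j / r^j`, so that `1 + ξ A′ = (1 - (rξ) S)ᵀ` and `det (1 + ξA′) = a(ξ)`;
* `B′ = e₀ · (1, 0, 1)`;
* `C′_v = -r · (Ê_{v,k+1} - Ê_{v,0} â_{k+1})_k` (rescaled shifted coefficient rows);
* `D′ = N₀ + E(0) · (1, 0, 1)`, `N₀` the single `-1` at `(0, 1)` (the 3-node trie `c₁ → c₁c₂`, `c₂`).
Pointwise, for `a(ξ) ≠ 0`, the Schur complement of `1 + ξA′` in the pencil is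
`1 + Y · (N₀ + e(ξ) (1,0,1))`, `e_v(ξ) = E_v(ξ)/a(ξ)` (shift realisation formula, hypothesis
`piece_d_shift`), whose determinant is `1 + e₁ y₁ + e₃ y₂ + e₂ y₁ y₂` (trie identity); the
polynomial identity follows on multiplying by `â ≠ 0` in the domain `ℂ[X_σ]`.  Entry bounds are
read off (`|â_{j+1} r| ≤ M`, `|C′| ≤ 2M`, `|B′|, |D′| ≤ 2`).
-/

noncomputable section

-- `Summit.<Summit>.<Problem>` repeats `ValiantsHypothesis` by the tree's layout convention (D-0017).
set_option linter.dupNamespace false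

namespace Summit.ValiantsHypothesis.ValiantsHypothesis.Theorems.PriceOfContractivity.OneLargeClass

open Matrix
open Literature.Analysis.OperatorTheory (eval_det_one_add_diagonal_mul_map_C det_pencil_reindex)

/-- Trie identity, shape `(c₁ ; c₁c₂ ; c₂)`: `det (1 + diag(y, z, z) · (N₀ + e · (1,0,1)))`. [folklore] -/
theorem det_one_add_diagonal_trie₃ {A : Type*} [CommRing A] (y z e₁ e₂ e₃ : A) :
    (1 + Matrix.diagonal ![y, z, z] * !![e₁, -1, e₁; e₂, 0, e₂; e₃, 0, e₃]).det =
      1 + e₁ * y + e₃ * z + e₂ * (y * z) := by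
  simp [Matrix.det_fin_three, Matrix.diagonal_mul]
  ring

/-- Substituting `ξ ↦ X_x` and evaluating. [folklore] -/
theorem eval_aeval_X {σ : Type} (x : σ) (q : Polynomial ℂ) (z : σ → ℂ) :
    MvPolynomial.eval z (Polynomial.aeval (MvPolynomial.X x : MvPolynomial σ ℂ) q) = q.eval (z x) := by
  rw [Polynomial.aeval_def, Polynomial.eval₂_eq_eval_map, Polynomial.eval_map]
  simp [Polynomial.eval₂_eq_sum_range, Polynomial.eval_eq_sum_range]

/-- Rescaled coefficient sums: `Σ_j (q_j / r^j) (rξ)^j = q(ξ)`. [folklore] -/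
theorem sum_rescaled_coeff {N : ℕ} (q : Polynomial ℂ) (hq : q.natDegree ≤ N + 1) {r : ℂ} (hr : r ≠ 0)
    (ξ : ℂ) : ∑ j ∈ Finset.range (N + 2), q.coeff j / r ^ j * (r * ξ) ^ j = q.eval ξ := by
  rw [Polynomial.eval_eq_sum_range' (Nat.lt_succ_of_le hq)]
  refine Finset.sum_congr rfl fun j _ => ?_
  rw [mul_pow]
  field_simp

/-! ### The blocks (introduced through hypotheses on their entries; no auxiliary definitions)

Throughout this section: `S` is the companion ("backward shift") matrix of the coefficient
sequence `b` (column `0` is `-(b₁, …, b_{N+1})`, `S_{k-1,k} = 1`), `A′ = -r Sᵀ`,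
`B′ = e₀ · (1, 0, 1)`, `C′_v = -r · (e_{v,k+1} - e_{v,0} b_{k+1})_k`, and the trie matrix with
coefficient column `ev` is `N₀ + ev · (1, 0, 1)`, `N₀` the single `-1` at `(0, 1)`. -/

section Blocks

variable {N : ℕ} (rc : ℂ) (b : ℕ → ℂ) (e : Fin 3 → ℕ → ℂ)
  (S : Matrix (Fin (N + 1)) (Fin (N + 1)) ℂ) (B' : Matrix (Fin (N + 1)) (Fin 3) ℂ)
  (C' : Matrix (Fin 3) (Fin (N + 1)) ℂ)
  (hS : ∀ i j : Fin (N + 1), S i j =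
    if (j : ℕ) = 0 then -b ((i : ℕ) + 1) else if (i : ℕ) + 1 = (j : ℕ) then (1 : ℂ) else 0)
  (hB : ∀ (i : Fin (N + 1)) (w : Fin 3), B' i w =
    if (i : ℕ) = 0 then (![(1 : ℂ), 0, 1] : Fin 3 → ℂ) w else 0)
  (hC : ∀ (v : Fin 3) (k : Fin (N + 1)), C' v k =
    -(rc * (e v ((k : ℕ) + 1) - e v 0 * b ((k : ℕ) + 1))))

/-- The trie identity for the trie matrix `N₀ + ev · (1,0,1)`:
`det (1 + diag(y₁, y₂, y₂) · (N₀ + ev · (1,0,1))) = 1 + ev₀ y₁ + ev₂ y₂ + ev₁ y₁ y₂`. [folklore] -/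
theorem det_one_add_diagonal_trieMat (y₁ y₂ : ℂ) (ev : Fin 3 → ℂ) :
    (1 + Matrix.diagonal ![y₁, y₂, y₂] *
        (Matrix.of fun v w : Fin 3 =>
          (!![(0 : ℂ), -1, 0; 0, 0, 0; 0, 0, 0] : Matrix (Fin 3) (Fin 3) ℂ) v w +
            (ev) v * (![(1 : ℂ), 0, 1] : Fin 3 → ℂ) w)).det =
      1 + ev 0 * y₁ + ev 2 * y₂ + ev 1 * (y₁ * y₂) := by
  have h : (Matrix.of fun v w : Fin 3 =>
          (!![(0 : ℂ), -1, 0; 0, 0, 0; 0, 0, 0] : Matrix (Fin 3) (Fin 3) ℂ) v w +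
            (ev) v * (![(1 : ℂ), 0, 1] : Fin 3 → ℂ) w) = !![ev 0, -1, ev 0; ev 1, 0, ev 1; ev 2, 0, ev 2] := by
    ext v w; fin_cases v <;> fin_cases w <;> simp
  rw [h, det_one_add_diagonal_trie₃]

/-- `1 + ξ A′ = (1 - (rξ) S)ᵀ` for `A′ = -r Sᵀ`. [folklore] -/
theorem one_add_smul_blkA (ξ : ℂ) : 1 + ξ • (-(rc • Sᵀ)) = (1 - (rc * ξ) • S)ᵀ := by
  ext i j
  simp only [Matrix.add_apply, Matrix.smul_apply, Matrix.neg_apply, Matrix.transpose_apply,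
    Matrix.sub_apply, Matrix.one_apply, smul_eq_mul, eq_comm (a := j) (b := i)]
  ring

include hB hC in
/-- Entries of `C′ (1 + ξA′)⁻¹ B′`: only the root columns are non-zero, and there the entry is
`-r ((1 - (rξ)S)⁻¹ ẽ_v)₀`. [folklore] -/
theorem blkC_inv_blkB_apply (ξ : ℂ) (v w : Fin 3) :
    (C' * (1 + ξ • (-(rc • Sᵀ)))⁻¹ * B') v w =
      (![(1 : ℂ), 0, 1] : Fin 3 → ℂ) w * -(rc * (((1 - (rc * ξ) • S)⁻¹ *ᵥ
        (fun k : Fin (N + 1) => e v ((k : ℕ) + 1) - e v 0 * b ((k : ℕ) + 1))) 0)) := by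
  rw [one_add_smul_blkA, ← Matrix.transpose_nonsing_inv, Matrix.mul_apply]
  have hB0 : ∀ i : Fin (N + 1), B' i w = if i = 0 then (![(1 : ℂ), 0, 1] : Fin 3 → ℂ) w else 0 := by
    intro i
    have hi : ((i : ℕ) = 0) ↔ i = 0 := by rw [Fin.ext_iff, Fin.val_zero]
    simp only [hB, hi]
  simp only [hB0, mul_ite, mul_zero, Finset.sum_ite_eq', Finset.mem_univ, if_true]
  rw [Matrix.mul_apply, Matrix.mulVec, dotProduct, mul_comm, Finset.mul_sum, Finset.mul_sum,
    ← Finset.sum_neg_distrib, Finset.mul_sum]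
  refine Finset.sum_congr rfl fun k _ => ?_
  simp only [hC, Matrix.transpose_apply]
  ring

include hS hB hC in
/-- **Pointwise Schur complement of the assembled pencil.**  With `b₀ = 1` and
`β := Σ b_j (rξ)^j ≠ 0`:
`det [[1 + ξA′, ξB′], [Y C′, 1 + Y D′]] = β · det (1 + Y · (N₀ + (ε/β) (1,0,1)))`,
`ε_v := Σ_k e_{v,k} (rξ)^k`, `D′ = N₀ + e_{·,0} (1,0,1)` (hypothesis: the statement of
`piece_d_shift`). [folklore] -/
theorem det_pencil_blocks_pointwise
    (hshift : ∀ (N : ℕ) (a : ℕ → ℂ), a 0 = 1 → ∀ ξ : ℂ,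
      (1 - ξ • Matrix.of (fun i j : Fin (N + 1) =>
          if (j : ℕ) = 0 then -a ((i : ℕ) + 1) else if (i : ℕ) + 1 = (j : ℕ) then (1 : ℂ) else 0)).det =
        ∑ j ∈ Finset.range (N + 2), a j * ξ ^ j ∧
      (∑ j ∈ Finset.range (N + 2), a j * ξ ^ j ≠ 0 → ∀ v : ℕ → ℂ,
        (∑ k ∈ Finset.range (N + 2), v k * ξ ^ k) / (∑ j ∈ Finset.range (N + 2), a j * ξ ^ j) - v 0 =
          ξ * ((1 - ξ • Matrix.of (fun i j : Fin (N + 1) =>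
              if (j : ℕ) = 0 then -a ((i : ℕ) + 1) else if (i : ℕ) + 1 = (j : ℕ) then (1 : ℂ) else 0))⁻¹ *ᵥ
            (fun k : Fin (N + 1) => v ((k : ℕ) + 1) - v 0 * a ((k : ℕ) + 1))) 0))
    (ξ : ℂ) (hb0 : b 0 = 1) (hβ : ∑ j ∈ Finset.range (N + 2), b j * (rc * ξ) ^ j ≠ 0)
    (y : Fin 3 → ℂ) :
    (Matrix.fromBlocks (1 + ξ • (-(rc • Sᵀ))) (ξ • B') (Matrix.diagonal y * C')
        (1 + Matrix.diagonal y *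
          (Matrix.of fun v w : Fin 3 =>
          (!![(0 : ℂ), -1, 0; 0, 0, 0; 0, 0, 0] : Matrix (Fin 3) (Fin 3) ℂ) v w +
            (fun v => e v 0) v * (![(1 : ℂ), 0, 1] : Fin 3 → ℂ) w))).det =
      (∑ j ∈ Finset.range (N + 2), b j * (rc * ξ) ^ j) *
        (1 + Matrix.diagonal y *
          (Matrix.of fun v w : Fin 3 =>
          (!![(0 : ℂ), -1, 0; 0, 0, 0; 0, 0, 0] : Matrix (Fin 3) (Fin 3) ℂ) v w +
            (fun v => (∑ k ∈ Finset.range (N + 2), e v k * (rc * ξ) ^ k) /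
              (∑ j ∈ Finset.range (N + 2), b j * (rc * ξ) ^ j)) v * (![(1 : ℂ), 0, 1] : Fin 3 → ℂ) w)).det := by
  have hSeq : S = Matrix.of (fun i j : Fin (N + 1) =>
      if (j : ℕ) = 0 then -b ((i : ℕ) + 1) else if (i : ℕ) + 1 = (j : ℕ) then (1 : ℂ) else 0) := by
    ext i j; rw [hS, Matrix.of_apply]
  obtain ⟨hdet, hreal⟩ := hshift N b hb0 (rc * ξ)
  -- `det (1 + ξA′) = β ≠ 0`
  have hP : (1 + ξ • (-(rc • Sᵀ))).det = ∑ j ∈ Finset.range (N + 2), b j * (rc * ξ) ^ j := by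
    rw [one_add_smul_blkA, Matrix.det_transpose, hSeq]
    exact hdet
  have hPu : IsUnit (1 + ξ • (-(rc • Sᵀ))).det := by rw [hP]; exact isUnit_iff_ne_zero.mpr hβ
  letI : Invertible (1 + ξ • (-(rc • Sᵀ))) := Matrix.invertibleOfIsUnitDet _ hPu
  rw [Matrix.det_fromBlocks₁₁, Matrix.invOf_eq_nonsing_inv, hP]
  congr 1
  -- the Schur complement is `1 + Y · (N₀ + (ε / β) (1,0,1))`
  set T0 : Matrix (Fin 3) (Fin 3) ℂ := (Matrix.of fun v w : Fin 3 =>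
    (!![(0 : ℂ), -1, 0; 0, 0, 0; 0, 0, 0] : Matrix (Fin 3) (Fin 3) ℂ) v w +
      (fun v => e v 0) v * (![(1 : ℂ), 0, 1] : Fin 3 → ℂ) w) with hT0
  have halg : 1 + Matrix.diagonal y * T0 -
      Matrix.diagonal y * C' * (1 + ξ • (-(rc • Sᵀ)))⁻¹ * (ξ • B') =
      1 + Matrix.diagonal y * (T0 - ξ • (C' * (1 + ξ • (-(rc • Sᵀ)))⁻¹ * B')) := by
    rw [Matrix.mul_sub, Matrix.mul_smul, Matrix.mul_smul, Matrix.mul_assoc, Matrix.mul_assoc,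
      Matrix.mul_assoc]
    abel
  rw [halg]
  congr 3
  ext v w
  rw [hT0]
  have hsh : (∑ k ∈ Finset.range (N + 2), e v k * (rc * ξ) ^ k) /
      (∑ j ∈ Finset.range (N + 2), b j * (rc * ξ) ^ j) - e v 0 =
      rc * ξ * (((1 - (rc * ξ) • S)⁻¹ *ᵥ
        (fun k : Fin (N + 1) => e v ((k : ℕ) + 1) - e v 0 * b ((k : ℕ) + 1))) 0) := by
    rw [hSeq]; exact hreal hβ (e v)
  have hZ := blkC_inv_blkB_apply rc b e S B' C' hB hC ξ v w
  simp only [Matrix.sub_apply, Matrix.smul_apply, smul_eq_mul, Matrix.of_apply, hZ]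
  linear_combination (-((![(1 : ℂ), 0, 1] : Fin 3 → ℂ) w)) * hsh

end Blocks

/-- Block form of a two-block pencil at a point. [folklore] -/
theorem one_add_diagonal_mul_fromBlocks {N : ℕ} (ξ : ℂ) (y : Fin 3 → ℂ)
    (A' : Matrix (Fin (N + 1)) (Fin (N + 1)) ℂ) (B' : Matrix (Fin (N + 1)) (Fin 3) ℂ)
    (C' : Matrix (Fin 3) (Fin (N + 1)) ℂ) (D' : Matrix (Fin 3) (Fin 3) ℂ) :
    1 + Matrix.diagonal (Sum.elim (fun _ => ξ) y) * Matrix.fromBlocks A' B' C' D' =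
      Matrix.fromBlocks (1 + ξ • A') (ξ • B') (Matrix.diagonal y * C') (1 + Matrix.diagonal y * D') := by
  ext (i | i) (j | j) <;> simp [Matrix.diagonal_mul, Matrix.one_apply]

/-- **Piece (d): assembly of the realisation.**  Hypothesis: the statement of `piece_d_shift`
verbatim.  Given colours `x, c₁, c₂`, a scale `r > 0`, a bound `M ≥ 1` and polynomials
`a, E₁, E₂, E₃` of degree `≤ N+1` with `a₀ = 1`, `|a_{j+1}|, |E_{v,j+1}| ≤ M r^j`, `|E_{v,0}| ≤ 1`,
there is an explicit `K₁` of size `N + 4` (blocks: `-r Sᵀ` for the rescaled companion matrix of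
`a`; `e₀ ⊗ (1,0,1)`; the rescaled shifted coefficient rows of the `E_v`; the 3-node trie
`[[E₁(0), -1, E₁(0)], [E₂(0), 0, E₂(0)], [E₃(0), 0, E₃(0)]]`) coloured `(x, …, x, c₁, c₂, c₂)`,
with all entries of modulus `≤ r + 2M` and pencil determinant
`â + Ê₁ X_{c₁} + Ê₃ X_{c₂} + Ê₂ X_{c₁} X_{c₂}`. [folklore] -/
theorem piece_d_assembly :
    (∀ (N : ℕ) (a : ℕ → ℂ), a 0 = 1 → ∀ ξ : ℂ,
      (1 - ξ • Matrix.of (fun i j : Fin (N + 1) =>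
          if (j : ℕ) = 0 then -a ((i : ℕ) + 1) else if (i : ℕ) + 1 = (j : ℕ) then (1 : ℂ) else 0)).det =
        ∑ j ∈ Finset.range (N + 2), a j * ξ ^ j ∧
      (∑ j ∈ Finset.range (N + 2), a j * ξ ^ j ≠ 0 → ∀ v : ℕ → ℂ,
        (∑ k ∈ Finset.range (N + 2), v k * ξ ^ k) / (∑ j ∈ Finset.range (N + 2), a j * ξ ^ j) - v 0 =
          ξ * ((1 - ξ • Matrix.of (fun i j : Fin (N + 1) =>
              if (j : ℕ) = 0 then -a ((i : ℕ) + 1) else if (i : ℕ) + 1 = (j : ℕ) then (1 : ℂ) else 0))⁻¹ *ᵥ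
            (fun k : Fin (N + 1) => v ((k : ℕ) + 1) - v 0 * a ((k : ℕ) + 1))) 0)) →
    ∀ {σ : Type} (x c₁ c₂ : σ) (N : ℕ) (r M : ℝ) (a E₁ E₂ E₃ : Polynomial ℂ),
      0 < r → 1 ≤ M → a.coeff 0 = 1 →
      a.natDegree ≤ N + 1 → E₁.natDegree ≤ N + 1 → E₂.natDegree ≤ N + 1 → E₃.natDegree ≤ N + 1 →
      (∀ j : ℕ, ‖a.coeff (j + 1)‖ ≤ M * r ^ j) →
      (∀ j : ℕ, ‖E₁.coeff (j + 1)‖ ≤ M * r ^ j) → (∀ j : ℕ, ‖E₂.coeff (j + 1)‖ ≤ M * r ^ j) →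
      (∀ j : ℕ, ‖E₃.coeff (j + 1)‖ ≤ M * r ^ j) →
      ‖E₁.coeff 0‖ ≤ 1 → ‖E₂.coeff 0‖ ≤ 1 → ‖E₃.coeff 0‖ ≤ 1 →
      ∃ (K₁ : Matrix (Fin (N + 4)) (Fin (N + 4)) ℂ) (κ₁ : Fin (N + 4) → σ),
        (∀ i j, ‖K₁ i j‖ ≤ r + 2 * M) ∧
        (1 + Matrix.diagonal (fun i => MvPolynomial.X (κ₁ i)) *
            K₁.map (fun a : ℂ => (MvPolynomial.C a : MvPolynomial σ ℂ))).det =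
          Polynomial.aeval (MvPolynomial.X x : MvPolynomial σ ℂ) a +
            Polynomial.aeval (MvPolynomial.X x : MvPolynomial σ ℂ) E₁ * MvPolynomial.X c₁ +
            Polynomial.aeval (MvPolynomial.X x : MvPolynomial σ ℂ) E₃ * MvPolynomial.X c₂ +
            Polynomial.aeval (MvPolynomial.X x : MvPolynomial σ ℂ) E₂ *
              (MvPolynomial.X c₁ * MvPolynomial.X c₂) := by
  intro hshift σ x c₁ c₂ N r M a E₁ E₂ E₃ hr hM ha0 hadeg hE₁ hE₂ hE₃ hac hE₁c hE₂c hE₃c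
    hE₁0 hE₂0 hE₃0
  classical
  -- the data
  set rc : ℂ := (r : ℂ) with hrc
  have hrc0 : rc ≠ 0 := by rw [hrc]; exact_mod_cast hr.ne'
  have hnrc : ‖rc‖ = r := by rw [hrc, Complex.norm_real, Real.norm_eq_abs, abs_of_pos hr]
  set â : ℕ → ℂ := fun j => a.coeff j / rc ^ j with hâ
  set Ev : Fin 3 → Polynomial ℂ := ![E₁, E₂, E₃] with hEv
  set Êv : Fin 3 → ℕ → ℂ := fun v j => (Ev v).coeff j / rc ^ j with hÊv
  set S : Matrix (Fin (N + 1)) (Fin (N + 1)) ℂ := Matrix.of (fun i j : Fin (N + 1) =>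
    if (j : ℕ) = 0 then -â ((i : ℕ) + 1) else if (i : ℕ) + 1 = (j : ℕ) then (1 : ℂ) else 0) with hSdef
  set B' : Matrix (Fin (N + 1)) (Fin 3) ℂ := Matrix.of (fun (i : Fin (N + 1)) (w : Fin 3) =>
    if (i : ℕ) = 0 then (![(1 : ℂ), 0, 1] : Fin 3 → ℂ) w else 0) with hB'def
  set C' : Matrix (Fin 3) (Fin (N + 1)) ℂ := Matrix.of (fun (v : Fin 3) (k : Fin (N + 1)) =>
    -(rc * (Êv v ((k : ℕ) + 1) - Êv v 0 * â ((k : ℕ) + 1)))) with hC'def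
  have hS : ∀ i j : Fin (N + 1), S i j =
      if (j : ℕ) = 0 then -â ((i : ℕ) + 1) else if (i : ℕ) + 1 = (j : ℕ) then (1 : ℂ) else 0 :=
    fun i j => rfl
  have hB : ∀ (i : Fin (N + 1)) (w : Fin 3), B' i w =
      if (i : ℕ) = 0 then (![(1 : ℂ), 0, 1] : Fin 3 → ℂ) w else 0 := fun i w => rfl
  have hC : ∀ (v : Fin 3) (k : Fin (N + 1)), C' v k =
      -(rc * (Êv v ((k : ℕ) + 1) - Êv v 0 * â ((k : ℕ) + 1))) := fun v k => rfl
  set Kb : Matrix (Fin (N + 1) ⊕ Fin 3) (Fin (N + 1) ⊕ Fin 3) ℂ :=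
    Matrix.fromBlocks (-(rc • Sᵀ)) B' C'
      (Matrix.of fun v w : Fin 3 =>
        (!![(0 : ℂ), -1, 0; 0, 0, 0; 0, 0, 0] : Matrix (Fin 3) (Fin 3) ℂ) v w +
          (fun v => Êv v 0) v * (![(1 : ℂ), 0, 1] : Fin 3 → ℂ) w) with hKb
  set cc : Fin 3 → σ := ![c₁, c₂, c₂] with hcc
  set κb : Fin (N + 1) ⊕ Fin 3 → σ := Sum.elim (fun _ => x) cc with hκb
  -- coefficient facts
  have hEvc : ∀ (v : Fin 3) (j : ℕ), ‖(Ev v).coeff (j + 1)‖ ≤ M * r ^ j := by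
    intro v j; fin_cases v; exacts [hE₁c j, hE₂c j, hE₃c j]
  have hEv0 : ∀ v : Fin 3, ‖(Ev v).coeff 0‖ ≤ 1 := by
    intro v; fin_cases v; exacts [hE₁0, hE₂0, hE₃0]
  have hEvdeg : ∀ v : Fin 3, (Ev v).natDegree ≤ N + 1 := by
    intro v; fin_cases v; exacts [hE₁, hE₂, hE₃]
  have hrr1 : ∀ w : Fin 3, ‖(![(1 : ℂ), 0, 1] : Fin 3 → ℂ) w‖ ≤ 1 := by
    intro w; fin_cases w <;> simp
  have hN₀1 : ∀ v w : Fin 3, ‖(!![(0 : ℂ), -1, 0; 0, 0, 0; 0, 0, 0] : Matrix (Fin 3) (Fin 3) ℂ) v w‖ ≤ 1 := by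
    intro v w; fin_cases v <;> fin_cases w <;> simp
  have hâ0 : â 0 = 1 := by simp [hâ, ha0]
  have hÊv0 : ∀ v : Fin 3, Êv v 0 = (Ev v).coeff 0 := by intro v; simp [hÊv]
  have hM0 : 0 ≤ M := le_trans zero_le_one hM
  set eN : Fin (N + 1) ⊕ Fin 3 ≃ Fin (N + 4) := finSumFinEquiv.trans (finCongr (by omega))
    with heN
  refine ⟨Matrix.reindex eN eN Kb, fun i => κb (eN.symm i), ?_, ?_⟩
  · -- entry bounds
    intro i j
    rw [Matrix.reindex_apply, Matrix.submatrix_apply]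
    have hrM : M ≤ r + 2 * M := by linarith
    have h2 : (2 : ℝ) ≤ r + 2 * M := by linarith
    rcases eN.symm i with i' | v <;> rcases eN.symm j with j' | w
    · -- `A'` block
      rw [hKb, Matrix.fromBlocks_apply₁₁, Matrix.neg_apply, Matrix.smul_apply,
        Matrix.transpose_apply, hS]
      simp only [smul_eq_mul, norm_neg, norm_mul, hnrc]
      split_ifs with h1 h2'
      · rw [norm_neg, hâ]
        simp only [norm_div, norm_pow, hnrc]
        calc r * (‖a.coeff ((j' : ℕ) + 1)‖ / r ^ ((j' : ℕ) + 1))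
            ≤ r * (M * r ^ (j' : ℕ) / r ^ ((j' : ℕ) + 1)) := by gcongr; exact hac _
          _ = M := by rw [pow_succ]; field_simp
          _ ≤ r + 2 * M := hrM
      · rw [norm_one, mul_one]; linarith
      · rw [norm_zero, mul_zero]; linarith
    · -- `B'` block
      rw [hKb, Matrix.fromBlocks_apply₁₂, hB]
      split_ifs
      · exact (hrr1 w).trans (by linarith)
      · rw [norm_zero]; linarith
    · -- `C'` block
      rw [hKb, Matrix.fromBlocks_apply₂₁, hC]
      simp only [norm_neg, norm_mul, hnrc, hÊv, hâ, pow_zero, div_one]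
      have hk : ‖(Ev v).coeff ((j' : ℕ) + 1) / rc ^ ((j' : ℕ) + 1) -
          (Ev v).coeff 0 * (a.coeff ((j' : ℕ) + 1) / rc ^ ((j' : ℕ) + 1))‖ ≤
          2 * M * r ^ (j' : ℕ) / r ^ ((j' : ℕ) + 1) := by
        refine (norm_sub_le _ _).trans ?_
        rw [norm_div, norm_mul, norm_div, norm_pow, hnrc]
        have e1 : ‖(Ev v).coeff ((j' : ℕ) + 1)‖ / r ^ ((j' : ℕ) + 1) ≤
            M * r ^ (j' : ℕ) / r ^ ((j' : ℕ) + 1) :=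
          div_le_div_of_nonneg_right (hEvc v _) (by positivity)
        have e2 : ‖(Ev v).coeff 0‖ * (‖a.coeff ((j' : ℕ) + 1)‖ / r ^ ((j' : ℕ) + 1)) ≤
            1 * (M * r ^ (j' : ℕ) / r ^ ((j' : ℕ) + 1)) := by
          gcongr
          · exact hEv0 v
          · exact hac _
        calc _ ≤ M * r ^ (j' : ℕ) / r ^ ((j' : ℕ) + 1) + 1 * (M * r ^ (j' : ℕ) / r ^ ((j' : ℕ) + 1)) :=
              add_le_add e1 e2
          _ = 2 * M * r ^ (j' : ℕ) / r ^ ((j' : ℕ) + 1) := by ring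
      calc r * _ ≤ r * (2 * M * r ^ (j' : ℕ) / r ^ ((j' : ℕ) + 1)) := by gcongr
        _ = 2 * M := by rw [pow_succ]; field_simp
        _ ≤ r + 2 * M := by linarith
    · -- `D'` block
      rw [hKb, Matrix.fromBlocks_apply₂₂, Matrix.of_apply]
      simp only [hÊv0]
      refine (norm_add_le _ _).trans ?_
      rw [norm_mul]
      calc _ ≤ 1 + 1 * (1 : ℝ) := by
            gcongr
            · exact hN₀1 v w
            · exact hEv0 v
            · exact hrr1 w
        _ ≤ r + 2 * M := by linarith
  · -- the pencil identity
    rw [det_pencil_reindex eN Kb κb]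
    -- pointwise, off the zero set of `a`
    have hpt : ∀ z : σ → ℂ, a.eval (z x) ≠ 0 →
        MvPolynomial.eval z (1 + Matrix.diagonal (fun i => MvPolynomial.X (κb i)) *
            Kb.map (fun a : ℂ => (MvPolynomial.C a : MvPolynomial σ ℂ))).det =
          MvPolynomial.eval z (Polynomial.aeval (MvPolynomial.X x : MvPolynomial σ ℂ) a +
            Polynomial.aeval (MvPolynomial.X x : MvPolynomial σ ℂ) E₁ * MvPolynomial.X c₁ +
            Polynomial.aeval (MvPolynomial.X x : MvPolynomial σ ℂ) E₃ * MvPolynomial.X c₂ +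
            Polynomial.aeval (MvPolynomial.X x : MvPolynomial σ ℂ) E₂ *
              (MvPolynomial.X c₁ * MvPolynomial.X c₂)) := by
      intro z hz
      have hβ : ∑ j ∈ Finset.range (N + 2), â j * (rc * z x) ^ j = a.eval (z x) :=
        sum_rescaled_coeff a hadeg hrc0 (z x)
      have hε : ∀ v : Fin 3, ∑ k ∈ Finset.range (N + 2), Êv v k * (rc * z x) ^ k =
          (Ev v).eval (z x) := fun v => sum_rescaled_coeff (Ev v) (hEvdeg v) hrc0 (z x)
      have hdiag : (fun i => z (κb i)) = Sum.elim (fun _ => z x) (fun w => z (cc w)) := by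
        funext i; rcases i with i | w <;> rfl
      have hβ0 : ∑ j ∈ Finset.range (N + 2), â j * (rc * z x) ^ j ≠ 0 := by rwa [hβ]
      rw [eval_det_one_add_diagonal_mul_map_C, hdiag, hKb, one_add_diagonal_mul_fromBlocks,
        det_pencil_blocks_pointwise rc â Êv S B' C' hS hB hC hshift (z x) hâ0 hβ0, hβ]
      simp only [hε]
      have hy : (fun w => z (cc w)) = ![z c₁, z c₂, z c₂] := by
        funext w; fin_cases w <;> simp [hcc]
      rw [hy, det_one_add_diagonal_trieMat]
      simp only [map_add, map_mul, eval_aeval_X, MvPolynomial.eval_X, hEv, Matrix.cons_val_zero,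
        Matrix.cons_val_one, Matrix.cons_val_two, Matrix.head_cons, Matrix.tail_cons]
      field_simp
    -- the polynomial identity: multiply by `â ≠ 0` in the domain `ℂ[X_σ]`
    have hne : (Polynomial.aeval (MvPolynomial.X x : MvPolynomial σ ℂ) a) ≠ 0 := by
      intro h
      have h0 := congrArg (MvPolynomial.eval (0 : σ → ℂ)) h
      rw [eval_aeval_X, map_zero, Pi.zero_apply, ← Polynomial.coeff_zero_eq_eval_zero, ha0] at h0
      exact one_ne_zero h0
    refine sub_eq_zero.mp ((mul_eq_zero.mp ?_).resolve_right hne)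
    refine MvPolynomial.funext fun z => ?_
    rw [map_mul, map_sub, map_zero, eval_aeval_X]
    by_cases hz : a.eval (z x) = 0
    · rw [hz, mul_zero]
    · rw [hpt z hz, sub_self, zero_mul]

end Summit.ValiantsHypothesis.ValiantsHypothesis.Theorems.PriceOfContractivity.OneLargeClass
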